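import Summits.Schanuel.Schanuel.Theorems.ZilberEacParamConstFibreGrowth
import Summits.Schanuel.Schanuel.Theorems.ZilberEacParamBaseComplete
import HarnessLib

/-!
# Polynomially parametrised base curves, LXXXII: CONSTANT FIBRES over a polynomial curve are dense
# unless the curve is a polynomial GRAPH in disguise (`g₁ = P ∘ g₀`)

HONEST FRAMING.  Cell `pub-schanuel` (Zilber's Exponential-Algebraic Closedness, case ladder;
host summit Schanuel), seat 2, gen 27.  File LXXIX left, over polynomial curves
`C = {(g₀(t), g₁(t))}` with `2 ≤ deg g₀ < deg g₁`, exactly the constant-fibre cylinders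
`S = C × {y₀ = θ} × ℂ` undecided.  **`unprojectedDense_constFibre_or_comp`** (any `deg g₀ ≥ 1`):
`S` has Zariski-dense exponential points UNLESS `g₁ = P ∘ g₀` for a polynomial `P` — i.e. unless the
base curve is the polynomial graph `x₁ = P(x₀)` (where constant fibres can indeed fail, e.g.
`{x₁ = x₀²/(2πi), y₀ = 1}`).  Proof: the exponential points are `g₀(t) ∈ τ + 2πiℤ`; along the `2d`
directions at infinity (file LXXX) `g₁(t) = Π(ζ⁻¹u) + r(μ)`, `u = |n|^{1/d}`; growth of `Re Π(ζ⁻¹u)`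
in the directions `ζ = 1` or `ζ = e^{iπ/d}` gives density (THEOREM G, file LXXXI); otherwise
`Π(u) = Π̃(u^d)` with `Re Π̃` constant (file LXXXI), the phases `e^{g₁(t_n)} = e^{Π̃(n)}e^{r(μ_n)}`
are POLYNOMIAL in the label `n`, and the trichotomy of file LXXVI gives density unless a relation
`H(g₀(t), exp(g₁(t) - Π̃((g₀(t) - τ)/2πi))) = 0` holds for all large `t`; since
`f = g₁ - Π̃((g₀ - τ)/2πi)` is a POLYNOMIAL, a non-constant `f` is impossible (`e^{f}` decays
super-polynomially on a ray while `g₀` grows polynomially: `eq_zero_of_eval₂_eq_zero_of_superdecay`),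
and a constant `f` says `g₁ = P ∘ g₀`.  The consequences for Mantova–Masser's question (with file
LXXIX: YES for every surface of their case over a polynomial curve with unequal degrees `≥ 2` that
is not a polynomial graph) are drawn in file LXXXIII.  What stays OPEN:
equal degrees with real leading ratio beyond the curvature condition; general algebraic base curves;
Fib(3,2); EC(3,2); NOT Schanuel's conjecture (neither used nor implied); EAC ⇏ SC.
-/

noncomputable section

open Filter Topology Set Complex MvPolynomial
open Literature.NumberTheory.Transcendental Literature.ModelTheory.Zilber
open Literature.ModelTheory.ExponentialFields

set_option linter.dupNamespace false

namespace Summit.Schanuel.Schanuel.Theorems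

/-! ## Part A. `e^{f(t)}` decays super-polynomially on a ray (`f` non-constant) -/

/-- **A ray of super-polynomial decay.**  For `f ∈ ℂ[t]` of degree `m ≥ 1` there is a sequence
`x_k → ∞` (on a ray where `lc(f) x^m` is negative real) with `‖e^{f(x_k)}‖ · ‖g(x_k)‖^N → 0` for
every polynomial `g` and every `N`. [folklore] -/
theorem exists_seq_exp_superdecay (f g : Polynomial ℂ) (hf : 1 ≤ f.natDegree) :
    ∃ x : ℕ → ℂ, Tendsto (fun k => ‖x k‖) atTop atTop ∧
      ∀ N : ℕ, Tendsto (fun k => ‖Complex.exp (f.eval (x k))‖ * ‖g.eval (x k)‖ ^ N) atTop (𝓝 0) := by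
  classical
  set m := f.natDegree with hm
  have hm0 : m ≠ 0 := by omega
  set a := f.leadingCoeff with ha
  have hf0 : f ≠ 0 := by rintro rfl; rw [Polynomial.natDegree_zero] at hm; omega
  have ha0 : a ≠ 0 := Polynomial.leadingCoeff_ne_zero.2 hf0
  -- the direction `ω` with `a ω^m = -1`
  obtain ⟨ω, hω⟩ := IsAlgClosed.exists_pow_nat_eq (-a⁻¹) (Nat.pos_of_ne_zero hm0)
  have haω : a * ω ^ m = -1 := by rw [hω]; field_simp
  have hω0 : ω ≠ 0 := by rintro rfl; rw [zero_pow hm0, mul_zero] at haω; norm_num at haω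
  have hωpos : 0 < ‖ω‖ := norm_pos_iff.2 hω0
  set x : ℕ → ℂ := fun k => (k : ℂ) * ω with hx
  have hxnorm : ∀ k, ‖x k‖ = k * ‖ω‖ := fun k => by rw [hx]; simp
  have hxtop : Tendsto (fun k => ‖x k‖) atTop atTop := by
    simp_rw [hxnorm]
    exact tendsto_natCast_atTop_atTop.atTop_mul_const hωpos
  -- the lower-order part: `f(kω) = -k^m + Σ_{j<m} f_j ω^j k^j`
  set S : ℝ := ∑ j ∈ Finset.range m, ‖f.coeff j‖ * ‖ω‖ ^ j with hS
  have hS0 : 0 ≤ S := Finset.sum_nonneg fun j _ => by positivity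
  have hre : ∀ k : ℕ, 1 ≤ k → (f.eval (x k)).re ≤ -(k : ℝ) ^ m + S * (k : ℝ) ^ (m - 1) := by
    intro k hk
    have hk1 : (1 : ℝ) ≤ k := by exact_mod_cast hk
    have hsplit : f.eval (x k) = -(k : ℂ) ^ m + ∑ j ∈ Finset.range m, f.coeff j * x k ^ j := by
      rw [Polynomial.eval_eq_sum_range, ← hm, Finset.sum_range_succ, add_comm]
      congr 1
      rw [hx]
      simp only
      rw [mul_pow, ← mul_assoc, mul_comm (f.coeff m) _, mul_assoc]
      rw [show f.coeff m = a from rfl, haω]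
      ring
    have hbound : ‖∑ j ∈ Finset.range m, f.coeff j * x k ^ j‖ ≤ S * (k : ℝ) ^ (m - 1) := by
      refine (norm_sum_le _ _).trans ?_
      rw [hS, Finset.sum_mul]
      refine Finset.sum_le_sum fun j hj => ?_
      have hjm : j ≤ m - 1 := by have := Finset.mem_range.1 hj; omega
      rw [norm_mul, norm_pow, hxnorm, mul_pow]
      have hkj : (k : ℝ) ^ j ≤ (k : ℝ) ^ (m - 1) := pow_le_pow_right₀ hk1 hjm
      have h1 : 0 ≤ ‖f.coeff j‖ * ‖ω‖ ^ j := by positivity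
      calc ‖f.coeff j‖ * ((k : ℝ) ^ j * ‖ω‖ ^ j) = ‖f.coeff j‖ * ‖ω‖ ^ j * (k : ℝ) ^ j := by ring
        _ ≤ ‖f.coeff j‖ * ‖ω‖ ^ j * (k : ℝ) ^ (m - 1) := mul_le_mul_of_nonneg_left hkj h1
    rw [hsplit, Complex.add_re]
    have h2 : (∑ j ∈ Finset.range m, f.coeff j * x k ^ j).re ≤ S * (k : ℝ) ^ (m - 1) :=
      (Complex.re_le_norm _).trans hbound
    have h3 : (-(k : ℂ) ^ m).re = -(k : ℝ) ^ m := by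
      rw [Complex.neg_re, ← Complex.ofReal_natCast, ← Complex.ofReal_pow, Complex.ofReal_re]
    rw [h3]
    linarith
  -- hence `Re f(kω) ≤ S - k` for `k ≥ S`, `k ≥ 1`
  have hre' : ∀ k : ℕ, 1 ≤ k → S ≤ k → (f.eval (x k)).re ≤ S - k := by
    intro k hk hSk
    have hk1 : (1 : ℝ) ≤ k := by exact_mod_cast hk
    have h := hre k hk
    have hpow1 : (1 : ℝ) ≤ (k : ℝ) ^ (m - 1) := one_le_pow₀ hk1
    have hkm : (k : ℝ) ^ m = (k : ℝ) ^ (m - 1) * k := by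
      rw [← pow_succ, Nat.sub_add_cancel (Nat.one_le_iff_ne_zero.2 hm0)]
    rw [hkm] at h
    nlinarith
  -- the polynomial bound `‖g(kω)‖ ≤ S₀ k^{d₀}` for `k ≥ 1`
  set d₀ := g.natDegree with hd₀
  set S₀ : ℝ := ∑ j ∈ Finset.range (d₀ + 1), ‖g.coeff j‖ * ‖ω‖ ^ j with hS₀
  have hS₀0 : 0 ≤ S₀ := Finset.sum_nonneg fun j _ => by positivity
  have hg : ∀ k : ℕ, 1 ≤ k → ‖g.eval (x k)‖ ≤ S₀ * (k : ℝ) ^ d₀ := by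
    intro k hk
    have hk1 : (1 : ℝ) ≤ k := by exact_mod_cast hk
    rw [Polynomial.eval_eq_sum_range, hS₀, Finset.sum_mul]
    refine (norm_sum_le _ _).trans (Finset.sum_le_sum fun j hj => ?_)
    have hjd : j ≤ d₀ := Nat.lt_succ_iff.1 (Finset.mem_range.1 hj)
    rw [norm_mul, norm_pow, hxnorm, mul_pow]
    have hkj : (k : ℝ) ^ j ≤ (k : ℝ) ^ d₀ := pow_le_pow_right₀ hk1 hjd
    have h1 : 0 ≤ ‖g.coeff j‖ * ‖ω‖ ^ j := by positivity
    calc ‖g.coeff j‖ * ((k : ℝ) ^ j * ‖ω‖ ^ j) = ‖g.coeff j‖ * ‖ω‖ ^ j * (k : ℝ) ^ j := by ring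
      _ ≤ ‖g.coeff j‖ * ‖ω‖ ^ j * (k : ℝ) ^ d₀ := mul_le_mul_of_nonneg_left hkj h1
  refine ⟨x, hxtop, fun N => ?_⟩
  -- squeeze against `C · k^{d₀ N} e^{-k}`
  have hmodel : Tendsto (fun k : ℕ => Real.exp S * S₀ ^ N * ((k : ℝ) ^ (d₀ * N) * Real.exp (-(k : ℝ))))
      atTop (𝓝 0) := by
    have h := (Real.tendsto_pow_mul_exp_neg_atTop_nhds_zero (d₀ * N)).comp tendsto_natCast_atTop_atTop
    have h2 := h.const_mul (Real.exp S * S₀ ^ N)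
    rw [mul_zero] at h2
    exact h2
  obtain ⟨K, hK⟩ := exists_nat_ge S
  refine squeeze_zero' (Eventually.of_forall fun k => by positivity) ?_ hmodel
  filter_upwards [eventually_ge_atTop (max K 1)] with k hk
  have hk1 : 1 ≤ k := le_trans (le_max_right _ _) hk
  have hSk : S ≤ k := hK.trans (by exact_mod_cast le_trans (le_max_left _ _) hk)
  have h1 : ‖Complex.exp (f.eval (x k))‖ ≤ Real.exp S * Real.exp (-(k : ℝ)) := by
    rw [Complex.norm_exp, ← Real.exp_add]
    exact Real.exp_le_exp.2 (by linarith [hre' k hk1 hSk])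
  have h2 : ‖g.eval (x k)‖ ^ N ≤ S₀ ^ N * (k : ℝ) ^ (d₀ * N) := by
    rw [pow_mul, ← mul_pow]
    exact pow_le_pow_left₀ (norm_nonneg _) (hg k hk1) N
  calc ‖Complex.exp (f.eval (x k))‖ * ‖g.eval (x k)‖ ^ N
      ≤ (Real.exp S * Real.exp (-(k : ℝ))) * (S₀ ^ N * (k : ℝ) ^ (d₀ * N)) :=
        mul_le_mul h1 h2 (by positivity) (by positivity)
    _ = Real.exp S * S₀ ^ N * ((k : ℝ) ^ (d₀ * N) * Real.exp (-(k : ℝ))) := by ring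

/-- **No relation `H(g₀(t), e^{f(t)}) = 0` for all large `t`** when `f, g₀ ∈ ℂ[t]` are non-constant
and `H ≠ 0`. [folklore] -/
theorem not_relation_exp_polynomial (g₀ f : Polynomial ℂ) (hg₀ : 1 ≤ g₀.natDegree)
    (hf : 1 ≤ f.natDegree) {H : Polynomial (Polynomial ℂ)} (hH0 : H ≠ 0) {R : ℝ}
    (hH : ∀ t : ℂ, R < ‖t‖ →
      (H.map (Polynomial.evalRingHom (g₀.eval t))).eval (Complex.exp (f.eval t)) = 0) : False := by
  obtain ⟨x, hxtop, hdec⟩ := exists_seq_exp_superdecay f g₀ hf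
  obtain ⟨K, hK⟩ := Filter.eventually_atTop.1 (hxtop.eventually (eventually_gt_atTop R))
  have hdeg : 0 < g₀.degree := by
    rw [Polynomial.degree_eq_natDegree (by rintro rfl; rw [Polynomial.natDegree_zero] at hg₀; omega)]
    exact_mod_cast hg₀
  have hz : Tendsto (fun k => ‖g₀.eval (x (k + K))‖) atTop atTop :=
    (g₀.tendsto_norm_atTop hdeg hxtop).comp (tendsto_add_atTop_nat K)
  refine hH0 (Literature.ModelTheory.Zilber.eq_zero_of_eval₂_eq_zero_of_superdecay H
    (fun k => g₀.eval (x (k + K))) (fun k => Complex.exp (f.eval (x (k + K)))) hz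
    (fun k => Complex.exp_ne_zero _) (fun N => (hdec N).comp (tendsto_add_atTop_nat K)) fun k => ?_)
  rw [← Polynomial.eval_map]
  exact hH _ (hK _ (Nat.le_add_left K k))

/-! ## Part B. Constant fibres: dense, or the curve is a polynomial graph -/

section Main

variable (g₀ g₁ : Polynomial ℂ) {Q : MvPolynomial (Fin 3) ℂ}

/-- A `Q ∈ ℂ[y₀]` (no monomial involves `t` or `y₁`) evaluates through the coordinate `y₀` alone.
[folklore] -/
theorem eval_eq_eval_of_support_y0 (hQ : ∀ m ∈ Q.support, m 0 = 0 ∧ m 2 = 0) (x x' : Fin 3 → ℂ)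
    (h : x 1 = x' 1) : MvPolynomial.eval x Q = MvPolynomial.eval x' Q := by
  classical
  rw [MvPolynomial.eval_eq', MvPolynomial.eval_eq']
  refine Finset.sum_congr rfl fun m hm => ?_
  obtain ⟨h0, h2⟩ := hQ m hm
  simp only [Fin.prod_univ_three, h0, h2, pow_zero, one_mul, mul_one, h]

/-- **Constant fibres over a polynomial curve: dense, or the curve is a polynomial graph.**
`deg g₀ ≥ 1`; `Q ∈ ℂ[y₀]` irreducible (no monomial involves `t` or `y₁`) with a zero `θ ≠ 0`
(torus fibres); then `S(g; Q) = {(g₀(t), g₁(t))} × {Q(y₀) = 0} × ℂ` has Zariski-dense exponential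
points, or `g₁ = P ∘ g₀` for some `P ∈ ℂ[X]`.
[cite: MantovaMasser2023, §1 Further remarks, p. 5 (the question, open in general)] (new) -/
theorem unprojectedDense_constFibre_or_comp (hd : 1 ≤ g₀.natDegree) (hirr : Irreducible Q)
    (hQ : ∀ m ∈ Q.support, m 0 = 0 ∧ m 2 = 0)
    (hfib : Set.Infinite {t : ℂ | ∃ c : Fin 2 → ℂ, c 0 ≠ 0 ∧ c 1 ≠ 0 ∧
      MvPolynomial.eval ![t, c 0, c 1] Q = 0}) :
    UnprojectedDense {w : Fin 2 ⊕ Fin 2 → ℂ | ∃ t : ℂ, w (Sum.inl 0) = g₀.eval t ∧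
      w (Sum.inl 1) = g₁.eval t ∧
      MvPolynomial.eval (Fin.cases t (fun i => w (Sum.inr i)) : Fin 3 → ℂ) Q = 0} ∨
    ∃ P : Polynomial ℂ, g₁ = P.comp g₀ := by
  classical
  set d := g₀.natDegree with hdd
  have hd0 : d ≠ 0 := by omega
  -- the fibre value `θ ≠ 0`
  obtain ⟨t₀, c, hc0, -, hc⟩ := hfib.nonempty
  set θ : ℂ := c 0 with hθdef
  have hθ0 : θ ≠ 0 := hc0
  have hθ : ∀ t y : ℂ, MvPolynomial.eval ![t, θ, y] Q = 0 := fun t y => by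
    rw [eval_eq_eval_of_support_y0 hQ ![t, θ, y] ![t₀, c 0, c 1] (by simp [hθdef])]
    exact hc
  set τ : ℂ := Complex.log θ with hτdef
  have hτ : Complex.exp τ = θ := Complex.exp_log hθ0
  -- `P₂ ∈ ℂ[t, y₀]` with `Q = P̃₂`, and its rows
  obtain ⟨P₂, hP₂Q⟩ := exists_rename_castSucc_eq (P := Q) fun m hm => (hQ m hm).2
  have hirr₂ : Irreducible P₂ := irreducible_of_rename_castSucc (by rw [hP₂Q]; exact hirr)
  set Q₂ : Polynomial (Polynomial ℂ) :=
    ∑ v ∈ P₂.support, Polynomial.monomial (v 1) (Polynomial.monomial (v 0) (P₂.coeff v)) with hQ₂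
  have hPQ : ∀ x y : ℂ, MvPolynomial.eval ![x, y] P₂ = (Q₂.map (Polynomial.evalRingHom x)).eval y :=
    fun x y => eval_eq_rowsPP P₂ x y
  have hP₂θ : ∀ t : ℂ, MvPolynomial.eval ![t, θ] P₂ = 0 := fun t => by
    rw [← eval_vec3_rename_castSucc P₂ t θ 0, hP₂Q]; exact hθ t 0
  -- the chart for `ψ ≡ θ`, `k = 1`
  obtain ⟨m, hman, hm0, hm', hchart⟩ :=
    exists_ramifiedChart_param g₀ hd (ψ := fun _ => θ) analyticAt_const hθ0 rfl τ (k := 1) le_rfl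
  have hchart' : ∀ᶠ s in 𝓝 (0 : ℂ), s ≠ 0 → m s ≠ 0 ∧
      (2 * Real.pi * I) * (m s ^ d)⁻¹ = g₀.eval s⁻¹ - τ := by
    filter_upwards [hchart] with s hs hs0
    obtain ⟨hms, hid⟩ := hs.2.2.2.2 hs0
    rw [one_mul, pow_one, div_self hθ0, Complex.log_one, sub_zero] at hid
    exact ⟨hms, hid⟩
  -- the witness (all directions)
  obtain ⟨r, Pl, m₀, hran, -, hside, -, hdir⟩ :=
    exists_constFibre_witness g₀ g₁ hd hτ hman hm0 hm' hchart'
  rw [or_iff_not_imp_left]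
  intro hnot
  -- direction `1`: no growth
  obtain ⟨μ, t, hμ, hμ0, hμlim, -, hzpolar, hexp, hnorm, hid₁⟩ :=
    hdir 1 1 (Or.inl rfl) (by rw [one_pow]; norm_num)
  obtain ⟨R₁, hR₁, hR₁c⟩ := exists_rePolyDir Pl 1
  have hdeg₁ : R₁.natDegree = 0 := by
    by_contra h
    exact hnot (unprojectedDense_constFibre_of_growth g₀ g₁ hd hirr hθ Pl (by simp) hran hμ hμlim hexp
      hid₁ hR₁ (by omega))
  -- direction `e^{iπ/d}`: no growth
  obtain ⟨hζ₁d, hζ₁n⟩ := halfTurnRoot_pow d hd0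
  obtain ⟨μ', t', hμ', -, hμ'lim, -, -, hexp', -, hid₁'⟩ :=
    hdir (Complex.exp (((Real.pi / d : ℝ) : ℂ) * I)) (-1) (Or.inr rfl) hζ₁d
  obtain ⟨R₂, hR₂, hR₂c⟩ := exists_rePolyDir Pl (Complex.exp (((Real.pi / d : ℝ) : ℂ) * I))
  have hdeg₂ : R₂.natDegree = 0 := by
    by_contra h
    exact hnot (unprojectedDense_constFibre_of_growth g₀ g₁ hd hirr hθ Pl hζ₁n hran hμ' hμ'lim hexp'
      hid₁' hR₂ (by omega))
  -- hence `Π(u) = Π̃(u^d)`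
  have hcoef : ∀ i, 1 ≤ i → ¬ d ∣ i → Pl.coeff i = 0 := fun i hi hdi =>
    coeff_eq_zero_of_re_dirs Pl hd0 (hR₁c hdeg₁) (hR₂c hdeg₂) hi hdi
  set Pt : Polynomial ℂ := Polynomial.contract d Pl with hPt
  have hPlPt : ∀ u : ℂ, Pl.eval u = Pt.eval (u ^ d) := eval_eq_eval_contract_pow Pl hd0 hcoef
  -- along the direction `1`: `g₁(t_j) = Π̃(m₀ + j) + r(μ_j)` — polynomial phases
  have hud : ∀ j, (μ j)⁻¹ ^ d = ((m₀ + j : ℕ) : ℂ) := by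
    intro j
    rw [hμ j, one_mul, inv_inv, ← Complex.ofReal_pow, ← hdd,
      Real.rpow_inv_natCast_pow (Nat.cast_nonneg _) hd0, Complex.ofReal_natCast]
  have hid₁' : ∀ j, g₁.eval (t j) = Pt.eval ((m₀ + j : ℕ) : ℂ) + r (μ j) := fun j => by
    rw [hid₁ j, hPlPt, hud j]
  -- the trichotomy (file LXXVI) leaves a relation
  set U₀ : ℂ → ℂ := fun u => (2 * Real.pi * I) + τ * u ^ d with hU₀
  have hU₀an : AnalyticAt ℂ U₀ 0 := analyticAt_const.add (analyticAt_const.mul (analyticAt_id.pow d))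
  have hteq : ∀ j, (Q₂.map (Polynomial.evalRingHom (t j))).eval (Complex.exp (g₀.eval (t j))) = 0 := by
    intro j; rw [hexp j, ← hPQ]; exact hP₂θ _
  have hrel : ∃ H : Polynomial (Polynomial ℂ), H ≠ 0 ∧
      ∀ᶠ u in 𝓝[≠] (0 : ℂ), (H.map (Polynomial.evalRingHom (U₀ u * u⁻¹ ^ d))).eval
        (Complex.exp (r u)) = 0 := by
    by_contra htr'
    have htr : ∀ H : Polynomial (Polynomial ℂ), H ≠ 0 →
        ¬ (∀ᶠ u in 𝓝[≠] (0 : ℂ), (H.map (Polynomial.evalRingHom (U₀ u * u⁻¹ ^ d))).eval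
          (Complex.exp (r u)) = 0) :=
      fun H hH0 hH => htr' ⟨H, hH0, hH⟩
    have h := unprojectedDense_of_ramified_witness_param g₀ g₁ hd Q₂ hPQ hirr₂ Pt hU₀an hran htr m₀
      hμ0 hμlim hzpolar hteq hnorm hid₁'
    rw [paramFibreCurveSurface_eq, hP₂Q] at h
    exact hnot h
  obtain ⟨H, hH0, hH⟩ := hrel
  -- transported to `s = 1/t`: `H(g₀(1/s), exp(g₁(1/s) - Π(1/m(s)))) = 0` on a punctured disc
  have hmne : ∀ᶠ s in 𝓝[≠] (0 : ℂ), m s ≠ 0 := by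
    refine eventually_nhdsWithin_iff.2 ?_
    filter_upwards [hchart'] with s hs hs0 using (hs hs0).1
  have hmtend : Tendsto m (𝓝[≠] (0 : ℂ)) (𝓝[≠] 0) := by
    refine tendsto_nhdsWithin_iff.2 ⟨?_, hmne⟩
    have h := hman.continuousAt.tendsto
    rw [hm0] at h
    exact h.mono_left nhdsWithin_le_nhds
  -- the polynomial `f = g₁ - Π̃((g₀ - τ)/2πi)`
  have h2πI : (2 * Real.pi * I : ℂ) ≠ 0 := by simp [Real.pi_ne_zero, Complex.I_ne_zero]
  set hP : Polynomial ℂ := Pt.comp (Polynomial.C (2 * Real.pi * I)⁻¹ * (Polynomial.X - Polynomial.C τ))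
    with hhP
  set f : Polynomial ℂ := g₁ - hP.comp g₀ with hf
  have hhPeval : ∀ z : ℂ, (hP.comp g₀).eval z = Pt.eval ((2 * Real.pi * I)⁻¹ * (g₀.eval z - τ)) := by
    intro z
    rw [hhP, Polynomial.eval_comp, Polynomial.eval_comp]
    simp
  have hrelz : ∀ᶠ s in 𝓝[≠] (0 : ℂ), (H.map (Polynomial.evalRingHom (g₀.eval s⁻¹))).eval
      (Complex.exp (f.eval s⁻¹)) = 0 := by
    filter_upwards [nhdsWithin_le_nhds hchart', hside, hmtend.eventually hH, self_mem_nhdsWithin]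
      with s hc hsd hHs hs0
    obtain ⟨hms, hid⟩ := hc hs0
    have hmsd : m s ^ d ≠ 0 := pow_ne_zero _ hms
    have e1 : U₀ (m s) * (m s)⁻¹ ^ d = g₀.eval s⁻¹ := by
      rw [hU₀]
      simp only
      rw [inv_pow, add_mul, mul_inv_cancel_right₀ hmsd]
      linear_combination hid
    have e2 : (m s)⁻¹ ^ d = (2 * Real.pi * I)⁻¹ * (g₀.eval s⁻¹ - τ) := by
      rw [inv_pow, ← hid, ← mul_assoc, inv_mul_cancel₀ h2πI, one_mul]
    have e3 : r (m s) = f.eval s⁻¹ := by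
      rw [hsd, hf, Polynomial.eval_sub, hhPeval, hPlPt, e2]
    rw [e1, e3] at hHs
    exact hHs
  obtain ⟨δ, hδ, hball⟩ := Metric.eventually_nhds_iff.1 (eventually_nhdsWithin_iff.1 hrelz)
  have hlarge : ∀ z : ℂ, δ⁻¹ < ‖z‖ →
      (H.map (Polynomial.evalRingHom (g₀.eval z))).eval (Complex.exp (f.eval z)) = 0 := by
    intro z hz
    have hzpos : 0 < ‖z‖ := lt_trans (inv_pos.2 hδ) hz
    have hz0 : z ≠ 0 := norm_pos_iff.1 hzpos
    have h := hball (y := z⁻¹) (by rw [dist_zero_right, norm_inv]; exact inv_lt_of_inv_lt₀ hδ hz)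
      (inv_ne_zero hz0)
    rwa [inv_inv] at h
  -- the dichotomy on `f`
  by_cases hfdeg : f.natDegree = 0
  · refine ⟨hP + Polynomial.C (f.coeff 0), ?_⟩
    have hfC := Polynomial.eq_C_of_natDegree_eq_zero hfdeg
    rw [Polynomial.add_comp, Polynomial.C_comp, ← hfC, hf]
    ring
  · exact (not_relation_exp_polynomial g₀ f hd (Nat.pos_of_ne_zero hfdeg) hH0 hlarge).elim

end Main

end Summit.Schanuel.Schanuel.Theorems
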